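import Literature.NumberTheory.IwasawaTheory.StickelbergerSeries
import Literature.NumberTheory.IwasawaTheory.CyclotomicUnitRegulator
import Literature.NumberTheory.ComplexMultiplication.EllipticUnits.SemilocalEllipticUnits
import HarnessLib

/-!
# `𝒞₇` genus road (crux `EllipticUnitValueSevenOfGZK`, K7r): the SHAPES of crux K1ᵘ
# `GenusFactorisationLambdaAdic` («`e_{η₁}θ^{𝔞} = G_𝔞 · e_{η₁}ξ`, `G_𝔞 = −½·u·(N𝔞 − σ_{N𝔞})·Θ`») and of the
# genus-residue statement (G6) («the class of `e_{η₁}θ^{𝔞}` in `𝓤^{η₁}/7𝓤^{η₁}` is non-zero»), at `p = 7`,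
# on a CONCRETE `𝒞₇`-frame — structures and `Prop`-valued predicates; NOTHING asserted, NO named fact

Cell bsd-cm, seat bsd-cm-k-ty1 g23, row (GENUS-PORT-A) block (B1a) of the scope `SCOPE-GENUS-PORT-F8.md`
(16530c741a99cc96) for the frozen proof-memo `MEMO-bsd-cm-genus` v1 (a38f3eedd2c92d58; tree reading copy
`Cruxes/EllipticUnitValueSevenOfGZK/MEMO-bsd-cm-genus.md` REV 1.2) §1 (N1)–(N8), §2 (P4)–(P6), §7 (G5) = crux K1ᵘ,
§8 (G6) + LEMMA M; card `Ideas/genus-kronecker-residue.md` REV 12.1 (`c₀ = −½`); scope checks (u, −½) = both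
constants VISIBLE in `genusFactor`.  HONEST LABEL: this file DEFINES; it proves no summit statement, closes no
item, registers no stub (the closed ∀/∃-forms of K1ᵘ are the pen's, in the skeleton `Lines/kato_perrin_riou_zp.lean`);
stmt-BirchSwinnertonDyer-19945 is OPEN; `X12.CMRamifiedSeven` is NOT proved; BSD is claimed for no curve.

## The idiom (that of `Kato2004/CMTwistedIwasawaModules.lean` `Frame1516` / `Kato15161WeakShape`)

Skeleton STRUCTURES with PINS in existing vocabulary + `Prop`-valued PREDICATES; existence NOT asserted.  CONCRETE
where the tree has the object: the ring is `Λ = IwasawaAlgebra 7 = ℤ₇⟦T⟧`, the semi-local units are a pinned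
`CyclotomicSemilocalUnitData 7 v (cyclotomicLayer F₀ 7) …` (F4), and the frame carries VERBATIM the binders of
`tsuji1999_thm31_colemanMap` at `(p, m, f, φ, i) = (7, |D|, |D|, χ_D, 5)`, so that block (B2) INVOKES Tsuji's
theorem for `η₁ = ω⁵χ_D` (case (i): `χ₁ = prim(ω⁴χ_D)`, `χ₁(7) = 0 ≠ 1`) instead of assuming a Coleman map.

## The objects (memo §1, §7) and how each is pinned

* **Frame** `GenusFrame` (memo (N1)–(N4), (N8)): `D < 0`, `D ≡ 1 (mod 4)`, squarefree, `7 ∤ D` (memo (N2): all the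
  proof uses); `N𝔞 ≥ 2` prime to `7|D|` (memo (N8); only `N𝔞` and the Artin symbol of `N𝔞` enter the `η₁`-line, §7 (b));
  `F₀ = ℚ(√D) ≤ ℚ(μ_{|D|}) ⊂ ℚ̄`, `K_n = cyclotomicLayer F₀ 7 n = ℚ(ζ_{7^{n+1}}, √D)` (memo (N4)); a compatible root system
  `ζsys` (F3); `u`, `γ₀` (`χ_cyc(γ₀) = u`, `T = γ₀ − 1`); `χD` mod `|D|` (primitive, `χD² = 1`, `χD(−1) = −1`: this IS
  `χ_D`, the unique primitive quadratic character of odd squarefree conductor `|D|`); `ω` Teichmüller; `η₁ : Υ →* ℤ₇ˣ`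
  read as `χD·ω⁵` through `ζsys 0` and trivial on `Gal(ℚ̄/K_∞)`; `g = g_{η₁}` (F1, `s`-direction); a `γ`-log table
  `r`; Tsuji's PINNED datum `U` of `𝓤 = lim← 𝓤_{K_n}` (F4).  Nothing is asserted to exist.
* **Datum** `GenusDatum F θu` over a frame and the GLOBAL family `θu n ∈ E(K_n)` — a PARAMETER: the memo's
  `θ_n = N_{K(7^{n+1}𝔣)/F′_n}(_𝔞z_{7^{n+1}𝔣})`, identified with Kato's units on the Kato side (row B) through the FRAME
  LEMMA (memo §3 (F3)–(F4)) and NOT pinned to them here (HONEST LIMIT: `K̄ ≠ ℚ̄` in the tree) —: the projector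
  `e = e_{η₁}` (`IsChiProjector`: values in `𝓤^{η₁}`, identity there, `e ∘ υ = η₁(υ)·e`; these determine
  `e_{η₁} = |G|⁻¹Σ η₁(g)⁻¹g`, `|G| = 12 ∈ ℤ₇ˣ`); the Sinnott family `ξu n = N_{ℚ(ζ_{m_n})/K_n}(1 − ζ_{m_n})` VALUE-PINNED by
  F4's `sinnottNorm`; pro-`7` pushes `θraw, ξraw ∈ 𝓤` (`rep n (48 • x) = (diag x_n)^48`: `48`-th powers of local units of
  `K_n` over `7` are principal — residue fields `𝔽₇`, `𝔽₄₉` — and `48 ∈ ℤ₇ˣ`); `θ = e θraw`, `ξ = e ξraw ∈ 𝓤^{η₁}`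
  («`e_{η₁}θ^𝔞`», «`e_{η₁}ξ`»); PINS `ξ ∈ 𝒞`, `𝒞^{η₁} = Λ·ξ` (memo (P5), Sinnott bookkeeping); `Θ ∈ Λ` = Iwasawa's
  Stickelberger series of the odd branch `ω⁴χ_D = η̄₃` PINNED by Lang's congruences (`IsStickelbergerSeries`, file
  `IwasawaTheory/StickelbergerSeries.lean`; memo §7 (b), (d)); `x ∈ Λ` = image of `N𝔞 − σ_{N𝔞}` on the `η₁`-line, PINNED
  mod every `h_j = (1+T)^{7^j} − 1` as `N𝔞 − η₁(N𝔞)(1+T)^{r_j(N𝔞)}` (LEMMA M's object); the branch unit `ub ∈ {±1, ±2}`.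
* **Predicates.** `genusFactor d = C(−½)·C(ub)·x·Θ` (`G_𝔞`, memo §7 K1ᵘ with `c₀ = −½` [REV 1.1]; both constants VISIBLE),
  `GenusFactorisationShape d :≡ θ = G_𝔞 • ξ`, `GenusResidueNonzeroShape d :≡ θ ∉ augIdealP 7 • ⊤ = 7·𝓤^{η₁}` (memo §8
  (G6); the crux currency of `ResidualNonvanishingSeven`).  CLOSED ∀/∃-forms are NOT defined here.
* ORIENTATION (memo (G5′)(e)): Lang's `f_{η₁,1}` has `κ`-components `B_{1,ω⁴χ_Dκ}`, the memo's `Θ` reads `B_{1,ω⁴χ_Dκ̄}`;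
  they differ by the involution `(1+T) ↦ (1+T)⁻¹`, which preserves `7Λ` — immaterial for (G6)/(B2).

## References
Frozen memo `MEMO-bsd-cm-genus` v1 (a38f3eedd2c92d58) §1, §2 (P4)–(P6), §7, §8; card REV 12.1; scope F8 (16530c741a99cc96);
K. Kato, Astérisque 295 (2004) §15.5–15.6 [Kato2004Asterisque]; T. Tsuji, J. Number Theory 78 (1999) §2–§3, §6
[Tsuji1999]; S. Lang, Cyclotomic Fields I–II (1990) Ch. 10 §1–§2 [Lang1990].
-/

noncomputable section

open scoped NumberField
open PowerSeries IsDedekindDomain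
open Literature.NumberTheory.EllipticCurves
open Literature.NumberTheory.EllipticCurves.IwasawaAlgebra
open Literature.NumberTheory.IwasawaTheory
open Literature.NumberTheory.IwasawaTheory.StickelbergerSeries
open Literature.NumberTheory.ComplexMultiplication.EllipticUnits

namespace Summit.BirchSwinnertonDyer.Rank1Residual.Additive.GenusSeven

/-! ## §1 The `η₁`-projector on a pinned semi-local unit datum (Tsuji's `e_χ`, `p ∤ |G|`) -/

section Projector

variable {p : ℕ} [Fact p.Prime] {v : HeightOneSpectrum (𝓞 ℚ)} {L : ℕ → IntermediateField ℚ (AlgebraicClosure ℚ)}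
  {hL : Monotone L} {Υ : Subgroup (Field.absoluteGaloisGroup ℚ)} {γ₀ : Field.absoluteGaloisGroup ℚ}

/-- **`IsChiProjector U χ e`: `e` is the idempotent `e_χ` of `𝓤` onto `𝓤^χ`** — a `Λ`-linear map with values in
the `χ`-part, the identity on the `χ`-part, and `e ∘ υ = χ(υ)·e` for every `υ ∈ Υ` (the relations
`e_χ·g = χ(g)e_χ`, `e_χ|_{M^χ} = id` of `e_χ = |G|⁻¹Σ_g χ(g)⁻¹g ∈ ℤ_p[G]`, `p ∤ |G|`; on `𝓤 = ⊕_ψ 𝓤^ψ` they determine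
`e`).  A predicate; nothing asserted. [cite: Tsuji1999, §2 Lemma 2.1 and §3 (p. 5–6, «e_χ = (1/#G)Σ χ(σ)σ⁻¹», «U^χ = e_χU»)] -/
def IsChiProjector (U : CyclotomicSemilocalUnitData p v L hL Υ γ₀) (χ : Υ →* ℤ_[p]ˣ)
    (e : U.M →ₗ[IwasawaAlgebra p] U.M) : Prop :=
  (∀ m : U.M, e m ∈ U.chiPart χ) ∧ (∀ m : U.M, m ∈ U.chiPart χ → e m = m) ∧
    ∀ (υ : Υ) (m : U.M), e (U.act υ m) = (C ((χ υ : ℤ_[p]ˣ) : ℤ_[p]) : IwasawaAlgebra p) • e m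

/-- Under `IsChiProjector`, `e m` lies in the `χ`-part. [cite: Tsuji1999, §2 Lemma 2.1 (pp. 3–4)] -/
theorem IsChiProjector.apply_mem {U : CyclotomicSemilocalUnitData p v L hL Υ γ₀} {χ : Υ →* ℤ_[p]ˣ}
    {e : U.M →ₗ[IwasawaAlgebra p] U.M} (he : IsChiProjector U χ e) (m : U.M) : e m ∈ U.chiPart χ :=
  he.1 m

end Projector

/-! ## §2 The `𝒞₇`-frame: the road data `(D, N𝔞)` and Tsuji's binders at `(ℚ(√D), 7, η₁ = ω⁵χ_D)` -/

/-- **A `𝒞₇` genus frame** (memo (N1)–(N4), (N8); module docstring «The frame»).  HYPOTHESIS STRUCTURE: the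
fields after `D`, `normA` are exactly the binders of `tsuji1999_thm31_colemanMap` at `(p, m, f, φ, i) =
(7, |D|, |D|, χ_D, 5)` plus a compatible root system and a `γ`-log table; nothing is asserted to exist.
[cite: Tsuji1999, §3 Thm 3.1 (p. 6) — the binders] [cite: Kato2004Asterisque, §15.5 (p. 253, the auxiliary ideal 𝔞 and N(𝔞))] -/
structure GenusFrame : Type 1 where
  /-- The discriminant `D` of `ℚ(√D)`: the class is `{(49a_i)^{(D)}}` (memo (N2)). -/
  D : ℤ
  D_neg : D < 0
  D_mod_four : D % 4 = 1
  D_squarefree : Squarefree D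
  not_seven_dvd_D : ¬ (7 : ℤ) ∣ D
  /-- `N𝔞`, the norm of the auxiliary ideal `𝔞 ≠ O_K` of `K = ℚ(√−7)`, prime to `7|D|` (memo (N8)). -/
  normA : ℕ
  two_le_normA : 2 ≤ normA
  normA_coprime : normA.Coprime (7 * D.natAbs)
  /-- The place `7` of `ℚ`. -/
  v : HeightOneSpectrum (𝓞 ℚ)
  seven_mem_v : ((7 : ℕ) : 𝓞 ℚ) ∈ v.asIdeal
  /-- `F₀ = ℚ(√D) ⊂ ℚ̄` (Tsuji's `F`). -/
  F₀ : IntermediateField ℚ (AlgebraicClosure ℚ)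
  F₀_eq : F₀ = IntermediateField.adjoin ℚ {x : AlgebraicClosure ℚ | x ^ 2 = (D : AlgebraicClosure ℚ)}
  /-- `ℚ(√D) ⊆ ℚ(μ_{|D|})` (conductor `|D|`, `D ≡ 1 mod 4`) — Tsuji's «`F` abelian, unramified at `p`». -/
  F₀_le : F₀ ≤ IntermediateField.adjoin ℚ {x : AlgebraicClosure ℚ | x ^ D.natAbs = 1}
  /-- A compatible system of primitive `7^{n+1}|D|`-th roots of unity (`(ζsys (n+1))^7 = ζsys n`). -/
  ζsys : ℕ → AlgebraicClosure ℚ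
  ζsys_compatible : CyclotomicUnits.IsCompatibleRootSystem D.natAbs 7 ζsys
  /-- A topological generator `u` of `1 + 7ℤ₇` (`κ(γ₀) = u`, `T = γ₀ − 1`). -/
  u : ℤ_[7]ˣ
  u_topGenerator : KubotaLeopoldt.IsTopGenerator 7 (u : ℤ_[7])
  /-- `γ₀ ∈ Γ_ℚ` with `χ_cyc(γ₀) = u`, fixing `K_0 = ℚ(ζ₇, √D)`. -/
  γ₀ : Field.absoluteGaloisGroup ℚ
  cyclotomicCharacter_γ₀ : Literature.NumberTheory.GaloisRepresentations.GaloisRep.cyclotomicCharacter ℚ 7 γ₀ = u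
  γ₀_mem : γ₀ ∈ fixingSubgroupQ (cyclotomicLayer F₀ 7 0)
  /-- `χ_D`, the quadratic character of `ℚ(√D)`, `ℤ₇`-valued, of conductor `|D|`. -/
  χD : DirichletCharacter ℤ_[7] D.natAbs
  χD_isPrimitive : χD.IsPrimitive
  χD_mul_self : χD * χD = 1
  χD_neg_one : χD (-1) = -1
  /-- The Teichmüller character `ω` mod `7`. -/
  ω : DirichletCharacter ℤ_[7] 7
  ω_teichmuller : IsTeichmullerCharacter 7 ω
  /-- `η₁ = χ_D·ω⁵` read mod `7|D|` is PRIMITIVE (conductor `7|D|`: `χ_D` and `ω⁵` are primitive of the coprime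
  conductors `|D|`, `7`) — Lang's «cond θ = dp»; a redundant pin (derivable from the two lines above), carried so
  that consumers need not redo the conductor bookkeeping. -/
  etaOne_isPrimitive : (DirichletCharacter.changeLevel (Dvd.intro 7 rfl) χD *
    (DirichletCharacter.changeLevel (Dvd.intro_left D.natAbs rfl) ω) ^ 5).IsPrimitive
  /-- The genus character `η₁ = ω⁵χ_D` of `Υ = Gal(ℚ̄/B_∞)` (EVEN, `ℤ₇`-valued). -/
  η₁ : torsionCyclotomicSubgroup 7 →* ℤ_[7]ˣ
  η₁_trivial : ∀ σ : torsionCyclotomicSubgroup 7,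
    (∀ n, (σ : Field.absoluteGaloisGroup ℚ) ∈ fixingSubgroupQ (cyclotomicLayer F₀ 7 n)) → η₁ σ = 1
  η₁_reading : IsDirichletReading 7 (torsionCyclotomicSubgroup 7) η₁ (ζsys 0) χD ω 5
  /-- `g = g_{η₁} ∈ Λ`, the Kubota–Leopoldt series of `η₁ = χ_D ω⁵` (`s`-direction, F1). -/
  g : IwasawaAlgebra 7
  g_spec : ∀ [NeZero D.natAbs], IsKubotaLeopoldtSeries 7 (χD.ringHomComp (KubotaLeopoldt.intAlgebraMap 7)) 5
    (u : ℤ_[7]) (PowerSeries.map (KubotaLeopoldt.intAlgebraMap 7) g)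
  /-- A table of `γ`-logarithms: `u^{r n a}·ω(a) ≡ a (mod 7^{n+1})`. -/
  r : ℕ → ℕ → ℕ
  r_logTable : IsLogTable 7 (u : ℤ_[7]) ω r
  /-- Tsuji's PINNED datum of `𝓤 = lim← 𝓤_{K_n}` along `K_n = ℚ(ζ_{7^{n+1}}, √D)` (F4; existence not asserted). -/
  U : CyclotomicSemilocalUnitData 7 v (cyclotomicLayer F₀ 7) (cyclotomicLayer_monotone F₀ 7)
    (torsionCyclotomicSubgroup 7) γ₀

namespace GenusFrame

variable (F : GenusFrame)

/-- `|D| ∈ ℕ`, the prime-to-`7` level (Lang's `d`, Tsuji's `m = f`). [cite: Lang1990, Ch. 10 §1 (PDF p. 167, «d ≥ 1 prime to p»)] -/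
abbrev d : ℕ := F.D.natAbs

/-- The `n`-th layer `K_n = F′_n = ℚ(ζ_{7^{n+1}}, √D) ⊂ ℚ̄` of the genus tower. [cite: Tsuji1999, §3 (p. 5, K_n = F(μ_{p^{n+1}}))] -/
abbrev layer (n : ℕ) : IntermediateField ℚ (AlgebraicClosure ℚ) := cyclotomicLayer F.F₀ 7 n

/-- `|D| ≠ 0`. [cite: Lang1990, Ch. 10 §1 (PDF p. 167, «d ≥ 1»)] -/
theorem d_ne_zero : F.d ≠ 0 := Int.natAbs_ne_zero.mpr F.D_neg.ne

/-- `0 < |D|`. [cite: Lang1990, Ch. 10 §1 (PDF p. 167, «d ≥ 1»)] -/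
theorem d_pos : 0 < F.d := Nat.pos_of_ne_zero F.d_ne_zero

/-- `7 ∤ |D|`, i.e. `|D|` is prime to `7` (Tsuji's `(m, p) = 1`). [cite: Tsuji1999, §3 (p. 5, «F unramified at p»)] -/
theorem d_coprime_seven : F.d.Coprime 7 := by
  rw [Nat.Coprime, Nat.gcd_comm, ← Nat.Coprime, Nat.Prime.coprime_iff_not_dvd (by norm_num)]
  intro h
  exact F.not_seven_dvd_D (Int.ofNat_dvd_left.mpr h)

/-- `N𝔞` is prime to `7`. [cite: Kato2004Asterisque, §15.5 (p. 253, «𝔞 prime to 6p𝔣»)] -/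
theorem normA_coprime_seven : F.normA.Coprime 7 :=
  Nat.Coprime.coprime_mul_right_right F.normA_coprime

/-- `N𝔞` is prime to `|D|`. [cite: Kato2004Asterisque, §15.5 (p. 253, «𝔞 prime to 6p𝔣»)] -/
theorem normA_coprime_d : F.normA.Coprime F.d :=
  Nat.Coprime.coprime_mul_left_right F.normA_coprime

/-- `N𝔞 ≠ 1` (the ideal `𝔞` is proper). [cite: Kato2004Asterisque, §15.6 (p. 254, N(𝔞) − σ_𝔞)] -/
theorem normA_ne_one : F.normA ≠ 1 := by
  have := F.two_le_normA; omega

/-- **Tsuji's parity condition at `(φ, i) = (χ_D, 5)`: `χ_D(−1) = (−1)^5`** — `η₁ = ω⁵χ_D` is EVEN (memo (N3)).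
[cite: Tsuji1999, §3 (p. 6, «χ a fixed, non-trivial, even character»)] -/
theorem χD_neg_one_eq_pow : F.χD (-1) = (-1) ^ 5 := by
  rw [F.χD_neg_one]; norm_num

/-- **Tsuji's case (i) at `(φ, i) = (χ_D, 5)`: `χ₁(7) ≠ 1`** (`χ₁ = prim(η₁ω⁻¹) = ω⁴χ_D` has conductor divisible
by `7`, so `χ₁(7) = 0`; typed `chiOneAtP 7 χD 5 = 0`). [cite: Tsuji1999, Thm 3.1 (i) (p. 6)] -/
theorem chiOneAtP_ne_one : chiOneAtP 7 F.χD 5 ≠ 1 := by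
  rw [chiOneAtP_of_ne_one 7 F.χD (by norm_num : (5 : ℕ) ≠ 1)]
  exact zero_ne_one

/-- `5 ≤ 7 − 2` (Tsuji's `0 ≤ i ≤ p − 2`). [cite: Tsuji1999, §4 (p. 12, «0 ≤ i ≤ p − 2»)] -/
theorem five_le : (5 : ℕ) ≤ 7 - 2 := by norm_num

/-- `(f, i) ≠ (1, 0)`, i.e. `η₁ ≠ 1`. [cite: Tsuji1999, §3 (p. 6, «non-trivial»)] -/
theorem nontrivial_reading : ¬ (F.d = 1 ∧ (5 : ℕ) = 0) := by
  rintro ⟨-, h⟩; exact absurd h (by norm_num)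

/-- **`η₁` read as a Dirichlet character mod `7|D|`: `χ_D · ω⁵`** (both characters lifted to the common level
`|D|·7`; Lang's even `θ` on `ℤ(dp)^*` with `d = |D|`). [cite: Lang1990, Ch. 10 §2 (PDF p. 171, «θ = even character on ℤ(dp)*, cond θ = d or dp»)] -/
def etaOneDirichlet : DirichletCharacter ℤ_[7] (F.d * 7) :=
  DirichletCharacter.changeLevel (Dvd.intro 7 rfl) F.χD *
    (DirichletCharacter.changeLevel (Dvd.intro_left F.d rfl) F.ω) ^ 5

/-- Unfolding `etaOneDirichlet`. [cite: Lang1990, Ch. 10 §2 (PDF p. 171)] -/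
theorem etaOneDirichlet_def : F.etaOneDirichlet =
    DirichletCharacter.changeLevel (Dvd.intro 7 rfl) F.χD *
      (DirichletCharacter.changeLevel (Dvd.intro_left F.d rfl) F.ω) ^ 5 := rfl

/-- `η₁` mod `7|D|` is primitive (the frame's pin; Lang's «cond θ = dp» with `d = |D|`).
[cite: Lang1990, Ch. 10 §2 (PDF p. 171, «cond θ = d or dp»)] -/
theorem etaOneDirichlet_isPrimitive : F.etaOneDirichlet.IsPrimitive := F.etaOne_isPrimitive

/-- Hence `cond η₁ = 7|D|` (in the form the Ferrero–Washington fact of `StickelbergerSeries.lean` asks for).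
[cite: Lang1990, Ch. 10 §2 Thm. 2.2–2.3 (PDF p. 172, «θ … of conductor d or dp»)] -/
theorem etaOneDirichlet_conductor : F.etaOneDirichlet.conductor = F.d ∨ F.etaOneDirichlet.conductor = F.d * 7 :=
  Or.inr F.etaOneDirichlet_isPrimitive

/-- **The odd branch `η₁ω⁻¹ = ω⁴χ_D = η̄₃` mod `7|D|`** whose Stickelberger elements build `Θ` (memo §7 (b), (d);
Lang's `θω⁻¹`). [cite: Lang1990, Ch. 10 §2 (PDF p. 171, «The character θω⁻¹ is odd»)] -/
def oddBranchSeven : DirichletCharacter ℤ_[7] (F.d * 7) :=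
  oddBranch 7 F.d F.etaOneDirichlet F.ω

/-- Unfolding `oddBranchSeven`. [cite: Lang1990, Ch. 10 §2 (PDF p. 171)] -/
theorem oddBranchSeven_def : F.oddBranchSeven = oddBranch 7 F.d F.etaOneDirichlet F.ω := rfl

/-- **`η₁(N𝔞) = χ_D(N𝔞)·ω(N𝔞)⁵ ∈ ℤ₇`** — the value of `η₁` at the Artin symbol `σ_{N𝔞}` (Dirichlet reading:
`σ_{N𝔞}(ζ) = ζ^{N𝔞}`); the scalar in LEMMA M's `x = N𝔞 − η₁(N𝔞)·(1+T)^t` (memo §8).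
[cite: Tsuji1999, §4 (p. 12, «χ = φω^i»)] -/
def etaOneNormA : ℤ_[7] :=
  F.χD (F.normA : ZMod F.d) * F.ω (F.normA : ZMod 7) ^ 5

/-- Unfolding `etaOneNormA`. [cite: Tsuji1999, §4 (p. 12)] -/
theorem etaOneNormA_def : F.etaOneNormA = F.χD (F.normA : ZMod F.d) * F.ω (F.normA : ZMod 7) ^ 5 := rfl

end GenusFrame

/-! ## §3 The datum: `e_{η₁}`, the pushed families, `ξ`-pins, `Θ`, `x`, the branch unit -/

/-- **A genus datum over a `𝒞₇`-frame and a global family `θu`** (module docstring «The datum»; memo (N5), (N8),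
§7, §8).  The PARAMETER `θu n ∈ E(K_n)` is the family of normed `𝔞`-elliptic units
`θ_n = N_{K(7^{n+1}𝔣)/F′_n}(_𝔞z_{7^{n+1}𝔣})` (memo (N8)) — the interface with the Kato side, which identifies it (FRAME
LEMMA, memo §3 (F3)–(F4)); this file does not pin it (HONEST LIMIT of the module docstring).  HYPOTHESIS STRUCTURE:
every field after the carriers is a PIN in existing vocabulary; nothing is asserted to exist.  The closed form «for
every frame and its elliptic family `θu` there is a datum with `GenusFactorisationShape`» is the crux K1ᵘ and is NOT
stated here.
[cite: Kato2004Asterisque, §15.5–15.6 (pp. 253–254: _𝔞z_𝔪, N(𝔞) − σ_𝔞)] [cite: Tsuji1999, §3 (pp. 5–6: 𝓤, 𝒞, 𝓤^χ), §6 (p. 20: Sinnott's units)] [cite: Lang1990, Ch. 10 §2 (2)–(3) (PDF p. 171)] -/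
structure GenusDatum (F : GenusFrame) (θu : ∀ n : ℕ, globalUnitsOf (F.layer n)) : Type where
  /-- `e = e_{η₁}`, the `η₁`-projector on `𝓤`. -/
  e : F.U.M →ₗ[IwasawaAlgebra 7] F.U.M
  e_isChiProjector : IsChiProjector F.U F.η₁ e
  /-- `ξ_n ∈ E(K_n)`: the Sinnott units `N_{ℚ(ζ_{m_n})/K_n}(1 − ζ_{m_n})`, `m_n = 7^{n+1}|D|`. -/
  ξu : ∀ n : ℕ, globalUnitsOf (F.layer n)
  ξu_val : ∀ n : ℕ, (((ξu n : globalUnitsOf (F.layer n)) : (AlgebraicClosure ℚ)ˣ) : AlgebraicClosure ℚ) =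
    CyclotomicUnits.sinnottNorm (t := 7 ^ (n + 1) * F.d) (F.layer n) (F.ζsys n) 1
  /-- The pro-`7` pushes of `(θ_n)_n`, `(ξ_n)_n` into `𝓤` (`rep n (48•x) = (diag x_n)^48`). -/
  θraw : F.U.M
  θraw_rep : ∀ n : ℕ, F.U.rep n (48 • θraw) = globalToSemilocalUnits F.v (F.layer n) (θu n) ^ 48
  ξraw : F.U.M
  ξraw_rep : ∀ n : ℕ, F.U.rep n (48 • ξraw) = globalToSemilocalUnits F.v (F.layer n) (ξu n) ^ 48
  /-- `θ = e_{η₁}θ^𝔞 ∈ 𝓤^{η₁}` and `ξ = e_{η₁}ξ ∈ 𝓤^{η₁}`. -/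
  θ : F.U.chiPart F.η₁
  θ_eq : (θ : F.U.M) = e θraw
  ξ : F.U.chiPart F.η₁
  ξ_eq : (ξ : F.U.M) = e ξraw
  /-- `e_{η₁}ξ ∈ 𝒞` and it generates `𝒞^{η₁}` over `Λ` (memo (P5)). -/
  ξ_mem_cyc : (ξ : F.U.M) ∈ F.U.cyc
  cycChi_eq_span : F.U.cycChi F.η₁ = Submodule.span (IwasawaAlgebra 7) {ξ}
  /-- `Θ ∈ Λ`: Iwasawa's Stickelberger series of the odd branch `ω⁴χ_D` (Lang's `f_{η₁,1}`), pinned by the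
  congruences of all levels `7^{n+1}|D|`. -/
  Θ : IwasawaAlgebra 7
  Θ_spec : IsStickelbergerSeries 7 F.d F.oddBranchSeven F.r Θ
  /-- `x ∈ Λ`: the image of `N𝔞 − σ_{N𝔞}` on the `η₁`-line, pinned modulo every `h_j = (1+T)^{7^j} − 1`. -/
  x : IwasawaAlgebra 7
  x_spec : ∀ j : ℕ, x - (C (F.normA : ℤ_[7]) - C F.etaOneNormA * (1 + X) ^ (F.r j F.normA)) ∈
    Ideal.span {layerModulus 7 j}
  /-- The branch unit `u ∈ {±1, ±2}` (card nit n1; scope check (u, −½)). -/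
  ub : ℤ
  ub_mem : ub = 1 ∨ ub = -1 ∨ ub = 2 ∨ ub = -2

namespace GenusDatum

variable {F : GenusFrame} {θu : ∀ n : ℕ, globalUnitsOf (F.layer n)} (d : GenusDatum F θu)

/-- **The constant `c₀ = −½ ∈ ℤ₇`** of Kronecker's limit formula (15.5.1) in the tree's normalisation (F5
`kato1551_kroneckerLimitFormula`; card REV 12) — VISIBLE, as the scope requires.
[cite: Kato2004Asterisque, §15.5 (15.5.1) (p. 253), with de Shalit 1987 II.5.1 (1) for the constant −½] -/
def cZero : ℤ_[7] := -Ring.inverse (2 : ℤ_[7])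

/-- `2` is a unit of `ℤ₇`. [cite: Lang1990, Ch. 10 §1 (PDF p. 167, p odd)] -/
theorem isUnit_two : IsUnit (2 : ℤ_[7]) := by
  rw [PadicInt.isUnit_iff]
  have h : ¬ ‖((2 : ℤ) : ℤ_[7])‖ < 1 := by
    rw [PadicInt.norm_int_lt_one_iff_dvd]; omega
  have h1 : ‖((2 : ℤ) : ℤ_[7])‖ ≤ 1 := PadicInt.norm_le_one _
  push_cast at h h1
  exact le_antisymm h1 (not_lt.mp h)

/-- `2 · Ring.inverse 2 = 1` in `ℤ₇` (so `cZero = −½` literally). [cite: Lang1990, Ch. 10 §1 (PDF p. 167)] -/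
theorem two_mul_inverse_two : (2 : ℤ_[7]) * Ring.inverse (2 : ℤ_[7]) = 1 :=
  Ring.mul_inverse_cancel _ isUnit_two

/-- `c₀ = −½` is a unit of `ℤ₇` (memo §11: `v₇(−½) = 0`). [cite: Kato2004Asterisque, §15.5 (15.5.1) (p. 253)] -/
theorem isUnit_cZero : IsUnit cZero :=
  (isUnit_ringInverse.mpr isUnit_two).neg

/-- The branch unit is a `7`-adic unit (`±1, ±2 ∈ ℤ₇ˣ`). [cite: Lang1990, Ch. 10 §1 (PDF p. 167)] -/
theorem isUnit_ub : IsUnit ((d.ub : ℤ) : ℤ_[7]) := by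
  rw [PadicInt.isUnit_iff]
  have h1 : ‖((d.ub : ℤ) : ℤ_[7])‖ ≤ 1 := PadicInt.norm_le_one _
  have h : ¬ ‖((d.ub : ℤ) : ℤ_[7])‖ < 1 := by
    rw [PadicInt.norm_int_lt_one_iff_dvd]
    rcases d.ub_mem with h | h | h | h <;> rw [h] <;> omega
  exact le_antisymm h1 (not_lt.mp h)

/-- **`G_𝔞 = −½ · u · (N𝔞 − σ_{N𝔞}) · Θ ∈ Λ`** — the genus factor of crux K1ᵘ (memo §7 STATEMENT K1ᵘ with
`c₀ = −½` [REV 1.1] and the branch unit `u`; both constants VISIBLE). [cite: Kato2004Asterisque, §15.5 (15.5.1) and §15.6 (pp. 253–254)] [cite: Lang1990, Ch. 10 §2 (2)–(3) (PDF p. 171)] -/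
def genusFactor : IwasawaAlgebra 7 :=
  C cZero * C ((d.ub : ℤ) : ℤ_[7]) * d.x * d.Θ

/-- Unfolding `genusFactor`. [cite: Kato2004Asterisque, §15.5–15.6 (pp. 253–254)] -/
theorem genusFactor_def : d.genusFactor = C cZero * C ((d.ub : ℤ) : ℤ_[7]) * d.x * d.Θ := rfl

end GenusDatum

/-! ## §4 The two predicates: K1ᵘ's identity and the genus residue (G6) -/

/-- **`GenusFactorisationShape d` — crux K1ᵘ `GenusFactorisationLambdaAdic` as a predicate on a datum**:
in `𝓤^{η₁}`, `e_{η₁}θ^{𝔞} = G_𝔞 · e_{η₁}ξ` with `G_𝔞 = −½·u·x·Θ` (memo §7).  A predicate; nothing asserted.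
[cite: Kato2004Asterisque, §15.5 (15.5.1) (p. 253)] [cite: Lang1990, Ch. 10 §2 (2)–(3) (PDF p. 171)] -/
def GenusFactorisationShape {F : GenusFrame} {θu : ∀ n : ℕ, globalUnitsOf (F.layer n)}
    (d : GenusDatum F θu) : Prop :=
  d.θ = d.genusFactor • d.ξ

/-- **`GenusResidueNonzeroShape d` — the genus residue (G6) read in `𝓤^{η₁}`**: the class of `e_{η₁}θ^{𝔞}` in
`𝓤^{η₁}/7𝓤^{η₁}` is non-zero, i.e. `θ ∉ (7)·𝓤^{η₁} = augIdealP 7 • ⊤` (the crux currency of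
`ResidualNonvanishingSeven`: «`z₀ ∉ augIdealP 7 • ⊤`»).  A predicate; nothing asserted.
[cite: Tsuji1999, Thm 3.1 (i) (p. 6)] [cite: Lang1990, Ch. 10 §2 Thm 2.3 (PDF p. 172)] -/
def GenusResidueNonzeroShape {F : GenusFrame} {θu : ∀ n : ℕ, globalUnitsOf (F.layer n)}
    (d : GenusDatum F θu) : Prop :=
  d.θ ∉ augIdealP 7 • (⊤ : Submodule (IwasawaAlgebra 7) (F.U.chiPart F.η₁))

/-- Unfolding `GenusResidueNonzeroShape`. [cite: Tsuji1999, Thm 3.1 (i) (p. 6)] -/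
theorem genusResidueNonzeroShape_iff {F : GenusFrame} {θu : ∀ n : ℕ, globalUnitsOf (F.layer n)}
    (d : GenusDatum F θu) :
    GenusResidueNonzeroShape d ↔
      d.θ ∉ augIdealP 7 • (⊤ : Submodule (IwasawaAlgebra 7) (F.U.chiPart F.η₁)) :=
  Iff.rfl

section Currency

variable {R : Type*} [CommRing R] {M : Type*} [AddCommGroup M] [Module R M]

/-- `m ∈ (a) • ⊤ ↔ m = a • w` for some `w` (bridge between the crux currency and divisibility).
[cite: Lang1990, Ch. 10 §1 (PDF p. 169, «f = p^m(…)», divisibility by p)] -/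
theorem mem_span_singleton_smul_top_iff (a : R) (m : M) :
    m ∈ (Ideal.span {a} : Ideal R) • (⊤ : Submodule R M) ↔ ∃ w : M, m = a • w := by
  rw [Submodule.ideal_span_singleton_smul, Submodule.mem_smul_pointwise_iff_exists]
  constructor
  · rintro ⟨b, -, rfl⟩
    exact ⟨b, rfl⟩
  · rintro ⟨w, rfl⟩
    exact ⟨w, Submodule.mem_top, rfl⟩

end Currency

/-- **(G6) in divisibility form**: `GenusResidueNonzeroShape d ↔ ¬ ∃ y ∈ 𝓤^{η₁}, e_{η₁}θ^𝔞 = 7·y`.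
[cite: Tsuji1999, Thm 3.1 (i) (p. 6)] [cite: Lang1990, Ch. 10 §2 Thm 2.3 (PDF p. 172)] -/
theorem genusResidueNonzeroShape_iff_not_exists {F : GenusFrame} {θu : ∀ n : ℕ, globalUnitsOf (F.layer n)}
    (d : GenusDatum F θu) :
    GenusResidueNonzeroShape d ↔
      ¬ ∃ y : F.U.chiPart F.η₁, d.θ = (C (7 : ℤ_[7]) : IwasawaAlgebra 7) • y := by
  rw [genusResidueNonzeroShape_iff, augIdealP, mem_span_singleton_smul_top_iff]
  rfl

/-- Under `GenusFactorisationShape`, the residue statement is a statement about `G_𝔞 · e_{η₁}ξ`.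
[cite: Kato2004Asterisque, §15.5 (15.5.1) (p. 253)] -/
theorem GenusFactorisationShape.residue_iff {F : GenusFrame} {θu : ∀ n : ℕ, globalUnitsOf (F.layer n)}
    {d : GenusDatum F θu}
    (h : GenusFactorisationShape d) :
    GenusResidueNonzeroShape d ↔
      d.genusFactor • d.ξ ∉ augIdealP 7 • (⊤ : Submodule (IwasawaAlgebra 7) (F.U.chiPart F.η₁)) := by
  rw [genusResidueNonzeroShape_iff, h]

end Summit.BirchSwinnertonDyer.Rank1Residual.Additive.GenusSeven

end
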